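import Summits.KontsevichZagierPeriods.KontsevichZagierPeriods.Theses.HurwitzMicroSectors
import Literature.NumberTheory.Transcendental.KZCalculusProofs
import Literature.NumberTheory.Transcendental.KZSemiCanonicalReductionProofs
import Literature.NumberTheory.Transcendental.KZLogCalculusProofs
import Literature.NumberTheory.Transcendental.KZUnfoldedStokesProofs
import Literature.NumberTheory.Transcendental.BoxIntegralHurwitzWeightTwo

/-!
# `HurwitzSectorComplement` (stmt-KontsevichZagierPeriods-14341, route HurwitzMicroSectors),
# line `galois-parity-half`: stub `stub_constAcrossDim` (S6) — constants across dimensions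

Two integral representations `ρ : KZ.IntegralRep w`, `ρ' : KZ.IntegralRep w'` whose domains are
the open unit boxes `(0,1)^w`, `(0,1)^{w'}` and whose integrands are the same rational constant `c`
on them are `KZ.Equivalent`, for ANY two dimensions `w`, `w'`.

Route (moves only, all from the Literature calculus):
* a constant representation `K_n(c) = [(0,1)ⁿ, c]` exists in every dimension (`exists_constRep`:
  the box is `ℚ`-semialgebraic, `KZ.isSemialgebraic_unitCube`; the constant is the polynomial
  `C c`; integrability `BoxIntegral.integrableOn_box_const`);
* ONE DIMENSION UP (`slab_equivalent`): the slab `K_n(c).slab 0 = [(0,1)ⁿ × [0,1], c]`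
  (one Newton–Leibniz move away from `K_n(c)`, `KZ.IntegralRep.equivalent_slab`) differs from any
  constant-`c` representation on `(0,1)ⁿ⁺¹` by the two NULL faces `{z_last = 0}`,
  `{z_last = 1}` only, hence by a relation (`KZ.of_sub_of_mem_relations_of_null`,
  `KZ.volume_setOf_last_eq_zero`);
* induction on the dimension (`equivalent_constRep_zero`): every constant-`c` box representation
  is equivalent to a fixed one in dimension `0`; compose (`KZ.Equivalent.trans/symm`).

References: M. Kontsevich, D. Zagier, *Periods* (2001), §1.2 rules (1), (3).
-/

noncomputable section

open Set MeasureTheory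
open scoped BigOperators
open Literature.NumberTheory.Transcendental

namespace Summit.KontsevichZagierPeriods.Theorems.HurwitzMicroSectorsHurwitzSectorComplement

namespace ConstAcrossDim

/-- **The constant representation on the open unit box exists** in every dimension `n`:
domain `{x | ∀ i, x i ∈ (0,1)}` (`ℚ`-semialgebraic, `KZ.isSemialgebraic_unitCube`), integrand
the constant `c` (the polynomial `C c`), integrable since the box has volume `1`.
[cite: KontsevichZagier2001, §1.1] -/
theorem exists_constRep (n : ℕ) (c : ℚ) :
    ∃ K : KZ.IntegralRep n, K.domain = {x | ∀ i, x i ∈ Ioo (0:ℝ) 1} ∧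
      K.integrand = fun _ => (c : ℝ) := by
  have hσ : Literature.ModelTheory.ExponentialFields.IsSemialgebraic ℚ
      {x : Fin n → ℝ | ∀ i, x i ∈ Ioo (0:ℝ) 1} := KZ.isSemialgebraic_unitCube n
  exact ⟨⟨{x | ∀ i, x i ∈ Ioo (0:ℝ) 1}, fun _ => (c : ℝ), hσ,
    (isSemialgebraicFunOn_aeval hσ (MvPolynomial.C c)).congr fun x _ => by simp,
    BoxIntegral.integrableOn_box_const n c⟩, rfl, rfl⟩

/-- **One dimension up.** The slab `[(0,1)ⁿ × [0,1], c]` at level `0` over the constant box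
representation `K = [(0,1)ⁿ, c]` and any representation `ρ` on the box `(0,1)ⁿ⁺¹` with
integrand `≡ c` there differ by a relation: the domains differ by (subsets of) the two null faces
`{z_last = 0} ∪ {z_last = 1}` and the integrands agree on the overlap
(`KZ.of_sub_of_mem_relations_of_null`). [cite: KontsevichZagier2001, §1.2 rule (1)] -/
theorem slab_equivalent {n : ℕ} (c : ℚ) (K : KZ.IntegralRep n) (ρ : KZ.IntegralRep (n + 1))
    (hKd : K.domain = {x | ∀ i, x i ∈ Ioo (0:ℝ) 1}) (hKi : K.integrand = fun _ => (c : ℝ))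
    (hρd : ρ.domain = {x | ∀ i, x i ∈ Ioo (0:ℝ) 1})
    (hρi : EqOn ρ.integrand (fun _ => (c : ℝ)) ρ.domain) :
    KZ.Equivalent (K.slab 0) ρ := by
  refine KZ.of_sub_of_mem_relations_of_null (K.slab 0) ρ ?_ ?_ ?_
  · -- `slab \ box ⊆ {z_last = 0} ∪ {z_last = 1}`, a null set
    refine measure_mono_null (t := {z | z (Fin.last n) = 0} ∪ {z | z (Fin.last n) = 1}) ?_
      (measure_union_null (KZ.volume_setOf_last_eq_zero 0) (KZ.volume_setOf_last_eq_zero 1))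
    rintro z ⟨hz1, hz2⟩
    simp only [KZ.IntegralRep.domain_slab, KZ.IntegralRep.slabDomain, mem_setOf_eq, Nat.cast_zero,
      zero_add, hKd] at hz1
    obtain ⟨hinit, h0, h1⟩ := hz1
    rw [hρd] at hz2
    simp only [mem_setOf_eq, not_forall] at hz2
    obtain ⟨i, hi⟩ := hz2
    obtain ⟨j, rfl⟩ | rfl := i.eq_castSucc_or_eq_last
    · exact (hi (hinit j)).elim
    · simp only [mem_Ioo, not_and, not_lt] at hi
      rcases h0.eq_or_lt with h | h
      · exact Or.inl h.symm
      · exact Or.inr (le_antisymm h1 (hi h))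
  · -- `box ⊆ slab`
    rw [sdiff_eq_empty.mpr ?_, measure_empty]
    intro z hz
    rw [hρd] at hz
    simp only [KZ.IntegralRep.domain_slab, KZ.IntegralRep.slabDomain, mem_setOf_eq, Nat.cast_zero,
      zero_add, hKd]
    exact ⟨fun j => hz (Fin.castSucc j), (hz (Fin.last n)).1.le, (hz (Fin.last n)).2.le⟩
  · -- the integrands are both `c` on the overlap
    intro z hz
    rw [KZ.IntegralRep.integrand_slab, hKi, hρi hz.2]

/-- **Induction on the dimension.** Every representation on an open unit box `(0,1)ⁿ` with
integrand `≡ c` is KZ-equivalent to a fixed constant representation `K₀ = [(0,1)⁰, c]` of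
dimension `0`: for `n = 0` by congruence (`KZ.of_sub_of_mem_relations_of_eqOn`), and
`[(0,1)ⁿ⁺¹, c] ∼ [(0,1)ⁿ, c].slab 0 ∼ [(0,1)ⁿ, c] ∼ K₀` (`slab_equivalent`, one
Newton–Leibniz move `KZ.IntegralRep.equivalent_slab`, induction).
[cite: KontsevichZagier2001, §1.2 rule (3)] -/
theorem equivalent_constRep_zero (c : ℚ) (K₀ : KZ.IntegralRep 0)
    (h₀d : K₀.domain = {x | ∀ i, x i ∈ Ioo (0:ℝ) 1})
    (h₀i : K₀.integrand = fun _ => (c : ℝ)) :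
    ∀ (n : ℕ) (ρ : KZ.IntegralRep n), ρ.domain = {x | ∀ i, x i ∈ Ioo (0:ℝ) 1} →
      EqOn ρ.integrand (fun _ => (c : ℝ)) ρ.domain → KZ.Equivalent ρ K₀
  | 0, ρ, hρd, hρi =>
      KZ.of_sub_of_mem_relations_of_eqOn (h₀d.trans hρd.symm) fun x hx => by rw [hρi hx, h₀i]
  | n + 1, ρ, hρd, hρi => by
      obtain ⟨K, hKd, hKi⟩ := exists_constRep n c
      have h1 : KZ.Equivalent K K₀ :=
        equivalent_constRep_zero c K₀ h₀d h₀i n K hKd fun x _ => congrFun hKi x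
      have h2 : KZ.Equivalent K (K.slab 0) := K.equivalent_slab 0
      have h3 : KZ.Equivalent (K.slab 0) ρ := slab_equivalent c K ρ hKd hKi hρd hρi
      exact (h2.trans h3).symm.trans h1

end ConstAcrossDim

/-- **S6 (constants across dimensions).** Equal rational constants on open unit boxes of any two
positive dimensions are KZ-equivalent (slabs + null faces).
[cite: KontsevichZagier2001, §1.2 rule (3)] -/
theorem stub_constAcrossDim : ∀ (w w' : ℕ) (c : ℚ) (ρ : KZ.IntegralRep w) (ρ' : KZ.IntegralRep w'), 1 ≤ w → 1 ≤ w' → ρ.domain = {x | ∀ i, x i ∈ Set.Ioo (0:ℝ) 1} → Set.EqOn ρ.integrand (fun _ => (c : ℝ)) ρ.domain → ρ'.domain = {x | ∀ i, x i ∈ Set.Ioo (0:ℝ) 1} → Set.EqOn ρ'.integrand (fun _ => (c : ℝ)) ρ'.domain → KZ.Equivalent ρ ρ' := by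
  intro w w' c ρ ρ' _ _ hρd hρi hρ'd hρ'i
  obtain ⟨K₀, h₀d, h₀i⟩ := ConstAcrossDim.exists_constRep 0 c
  exact (ConstAcrossDim.equivalent_constRep_zero c K₀ h₀d h₀i w ρ hρd hρi).trans
    (ConstAcrossDim.equivalent_constRep_zero c K₀ h₀d h₀i w' ρ' hρ'd hρ'i).symm

end Summit.KontsevichZagierPeriods.Theorems.HurwitzMicroSectorsHurwitzSectorComplement

end
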